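import Mathlib
import HarnessLib

/-!
# Kollár–Szabó going down, glue for the local step: residue fields along residue-surjective local maps,
# and the action induced on the quotient by a stable ideal
# (crux `WildQuotients.WildQuotientResolution`, stub `stub_phaseZeroHighDim`)

Crux stmt-ResolutionOfSingularities-15640 (`WildQuotientResolution`), registered stub `stub_phaseZeroHighDim`; programme:
`KollarSzaboGoingDown_holds` via ✓`kollarSzaboGoingDown_of_localStepLE` and the equivariant quadratic transform
`R₁` (✓`EigenlineChart.exists_equivariant_quadraticTransform`, hand 8-g1). Two glue lemmas of the remaining list
(memo KS-GOINGDOWN-ASSEMBLY.md, evidence on 15640):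

* (P3) `isAlgClosed_residueField_of_residue_surjective` — if `f : S → R₁` is a local homomorphism of local rings and
  every element of `R₁` is congruent modulo `𝔪_{R₁}` to an element of `f(S)` ("same residue field", a conclusion of
  `exists_equivariant_quadraticTransform`), then `κ(R₁)` is algebraically closed when `κ(S)` is
  (`κ(S) → κ(R₁)` is a surjective field homomorphism, hence an isomorphism);
  `bijective_residueField_map_of_residue_surjective` — the bijectivity itself.
* (P5a) `exists_quotient_ringAut` — an action `τ : G →* (R ≃+* R)` stabilising an ideal `I` (`τ g (I) ⊆ I`) induces
  `τ̄ : G →* ((R ⧸ I) ≃+* (R ⧸ I))` with `τ̄ g (r mod I) = τ g r mod I` (for `I = (t) ⊂ R₁`: the action on the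
  exceptional divisor `E = Spec (R₁/(t))`); `map_eq_of_forall_mem` — `I.map (τ g) = I` under the stability hypothesis.

[OURS · crux stmt-ResolutionOfSingularities-15640 · helper toward `stub_phaseZeroHighDim` (glue for the discharge of a
named fact; NOT a proof of the stub); counted 0; AI-level work, weaker than expert review.] [folklore]
-/

-- single-problem summit: the doubled namespace component `ResolutionOfSingularities` is forced
set_option linter.dupNamespace false

noncomputable section

open IsLocalRing

namespace Summit.ResolutionOfSingularities.ResolutionOfSingularities.Theorems.WildQuotientResolution.KSGoingDown

universe u v w

/-! ## (P3) Residue fields along residue-surjective local homomorphisms -/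

section Residue

variable {S R : Type u} [CommRing S] [IsLocalRing S] [CommRing R] [IsLocalRing R]
  (f : S →+* R) [IsLocalHom f]

/-- If every element of `R` is congruent mod `𝔪_R` to an element of `f(S)`, the induced map of residue fields
`κ(S) → κ(R)` is bijective. [folklore] -/
theorem bijective_residueField_map_of_residue_surjective
    (hsurj : ∀ z : R, ∃ s : S, z - f s ∈ maximalIdeal R) :
    Function.Bijective (ResidueField.map f) := by
  refine ⟨RingHom.injective (ResidueField.map f), fun y => ?_⟩
  obtain ⟨z, rfl⟩ := Ideal.Quotient.mk_surjective y
  obtain ⟨s, hs⟩ := hsurj z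
  refine ⟨residue S s, ?_⟩
  change residue R (f s) = residue R z
  rw [← sub_eq_zero, ← map_sub, residue_eq_zero_iff]
  have : f s - z = -(z - f s) := by ring
  rw [this]
  exact (maximalIdeal R).neg_mem hs

/-- **(P3) Same residue field ⇒ algebraically closed residue field is inherited**: for a local homomorphism
`f : S → R` with every element of `R` congruent mod `𝔪_R` to an element of `f(S)`, `κ(R)` is algebraically
closed when `κ(S)` is. [folklore] -/
theorem isAlgClosed_residueField_of_residue_surjective [IsAlgClosed (ResidueField S)]
    (hsurj : ∀ z : R, ∃ s : S, z - f s ∈ maximalIdeal R) : IsAlgClosed (ResidueField R) :=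
  IsAlgClosed.of_ringEquiv (ResidueField S) _
    (RingEquiv.ofBijective (ResidueField.map f) (bijective_residueField_map_of_residue_surjective f hsurj))

end Residue

/-! ## (P5a) The action on the quotient by a stable ideal -/

section QuotientAction

variable {R : Type u} [CommRing R] {G : Type v} [Group G] (τ : G →* (R ≃+* R)) (I : Ideal R)

/-- A `G`-stable ideal is mapped ONTO itself by every `τ g` (apply stability to `g⁻¹`). [folklore] -/
theorem map_eq_of_forall_mem (hI : ∀ (g : G), ∀ r ∈ I, τ g r ∈ I) (g : G) :
    I.map ((τ g : R ≃+* R) : R →+* R) = I := by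
  apply le_antisymm
  · rw [Ideal.map_le_iff_le_comap]
    intro r hr
    exact hI g r hr
  · intro r hr
    have h1 : τ g⁻¹ r ∈ I := hI g⁻¹ r hr
    have h2 : (τ g) (τ g⁻¹ r) = r := by
      change (τ g * τ g⁻¹) r = r
      rw [← map_mul, mul_inv_cancel, map_one]
      rfl
    rw [← h2]
    exact Ideal.mem_map_of_mem _ h1

/-- **(P5a) The action induced on `R ⧸ I` by an action stabilising `I`**: there is
`τ̄ : G →* ((R ⧸ I) ≃+* (R ⧸ I))` with `τ̄ g (r mod I) = (τ g r) mod I`. [folklore] -/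
theorem exists_quotient_ringAut (hI : ∀ (g : G), ∀ r ∈ I, τ g r ∈ I) :
    ∃ τq : G →* ((R ⧸ I) ≃+* (R ⧸ I)),
      ∀ (g : G) (r : R), τq g (Ideal.Quotient.mk I r) = Ideal.Quotient.mk I (τ g r) := by
  let e : G → ((R ⧸ I) ≃+* (R ⧸ I)) := fun g =>
    Ideal.quotientEquiv I I (τ g) (map_eq_of_forall_mem τ I hI g).symm
  have he : ∀ (g : G) (r : R), e g (Ideal.Quotient.mk I r) = Ideal.Quotient.mk I (τ g r) :=
    fun g r => Ideal.quotientEquiv_mk I I (τ g) _ r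
  refine ⟨{ toFun := e, map_one' := ?_, map_mul' := ?_ }, fun g r => he g r⟩
  · apply RingEquiv.ext
    intro y
    obtain ⟨r, rfl⟩ := Ideal.Quotient.mk_surjective y
    rw [he, map_one]
    rfl
  · intro g h
    apply RingEquiv.ext
    intro y
    obtain ⟨r, rfl⟩ := Ideal.Quotient.mk_surjective y
    rw [he, map_mul]
    change Ideal.Quotient.mk I ((τ g) ((τ h) r)) = e g (e h (Ideal.Quotient.mk I r))
    rw [he, he]

end QuotientAction

end Summit.ResolutionOfSingularities.ResolutionOfSingularities.Theorems.WildQuotientResolution.KSGoingDown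

end
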